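import Mathlib
import Literature.Probability.RandomPlanarGeometry.ChordalCurveFamily
import Literature.Probability.RandomPlanarGeometry.CurveClassStopAtMeasurable
import HarnessLib

/-!
# Markov kernel of a chordal family carried by simple curves (packaging E3)

Crux `AxiomsOfLimit` (stmt-CriticalPhenomena-1370), line `registered`, stub `stub_markovOfLimit`,
packaging step (E3) of the Markov clause (lead c4). Theorems only.

Assuming the class-level soft-Markov theorem (hypothesis `hSoft`, the conclusion of the
neighbouring stub `stub_softMarkovAllF`): every probability law `μ` on curve classes carried by
simple curves in a ball `Metric.ball 0 R` running from `a` to `b ≠ a` admits a map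
`Q : CurveClass ℂ → Measure (CurveClass ℂ)` with `Q (const a) = μ` and the Markov disintegration of
`μ` along `(stopAt F, startFrom F)` for every closed `F`. From it we obtain the `initial` and
`markov` clauses of `ChordalFamily.IsMarkovExtension` for every chordal family `P` carried by
simple boundary-avoiding curves: for each Dobrushin domain `D` the law `P D` is a probability
measure carried by curves from `D.pt 0` to `D.pt 1` (distinct marked points,
`MarkedDomain.pt_injective`) inside `closure D.carrier`, which is bounded
(`JordanDomain.isBounded`) and hence inside some ball `Metric.ball 0 R`; instantiating `hSoft` at
`μ := P D` and choosing gives the kernel `Q : DobrushinDomain → CurveClass ℂ → Measure`.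

* `stub_markovInitialOfChordalSimple` — the registered signature.

Folklore (packaging of a disintegration statement). All `[folklore]`.
-/

noncomputable section

open MeasureTheory Filter Set
open scoped ENNReal

namespace Summit.CriticalPhenomena.SAWScalingLimit.Theorems.AxiomsOfLimitMarkov

open Literature.Probability.RandomPlanarGeometry

/-- The closure of a Dobrushin domain lies in an open ball `Metric.ball 0 R` of positive radius.
[folklore] -/
theorem dobrushinDomain_closure_subset_ball (D : DobrushinDomain) :
    ∃ R : ℝ, 0 < R ∧ closure D.carrier ⊆ Metric.ball (0 : ℂ) R :=
  D.isBounded.closure.subset_ball_lt 0 0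

/-- Per-domain instantiation of the soft-Markov theorem: for a chordal family `P` carried by
simple curves, each law `P D` admits a map `Q` with `Q (const (D.pt 0)) = P D` and the Markov
disintegration along `(stopAt F, startFrom F)` for every closed `F`. [folklore] -/
theorem exists_markovKernel_of_isChordal_of_simple
    (hSoft : ∀ (μ : Measure (CurveClass ℂ)) [IsProbabilityMeasure μ] (a b : ℂ) (R : ℝ),
      0 < R → a ≠ b →
      (∀ᵐ c ∂μ, c ∈ CurveClass.simple ∧ c.range ⊆ Metric.ball (0 : ℂ) R ∧
        c.source = a ∧ c.target = b) →
      ∃ Q : CurveClass ℂ → Measure (CurveClass ℂ), Q (CurveClass.mk (Curve.const a)) = μ ∧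
        ∀ F : Set ℂ, IsClosed F → ∀ S T : Set (CurveClass ℂ), MeasurableSet S →
          MeasurableSet T →
          μ (CurveClass.stopAt F ⁻¹' S ∩ CurveClass.startFrom F ⁻¹' T) =
            ∫⁻ γ in CurveClass.stopAt F ⁻¹' S, Q (γ.stopAt F) T ∂μ)
    (P : ChordalFamily) (hch : P.IsChordal)
    (h6 : ∀ D : DobrushinDomain, ∀ᵐ γ ∂(P D),
      γ ∈ CurveClass.simple ∧ γ.range ∩ frontier D.carrier ⊆ {D.pt 0, D.pt 1})
    (D : DobrushinDomain) :
    ∃ Q : CurveClass ℂ → Measure (CurveClass ℂ),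
      Q (CurveClass.mk (Curve.const (D.pt 0))) = P D ∧
        ∀ F : Set ℂ, IsClosed F → ∀ S T : Set (CurveClass ℂ), MeasurableSet S →
          MeasurableSet T →
          P D (CurveClass.stopAt F ⁻¹' S ∩ CurveClass.startFrom F ⁻¹' T) =
            ∫⁻ γ in CurveClass.stopAt F ⁻¹' S, Q (γ.stopAt F) T ∂(P D) := by
  haveI := (hch D).1
  obtain ⟨R, hR0, hR⟩ := dobrushinDomain_closure_subset_ball D
  -- the two marked points are distinct (`MarkedDomain.pt_injective`)
  have hne : D.pt 0 ≠ D.pt 1 := fun h => absurd (D.pt_injective h) (by decide)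
  refine hSoft (P D) (D.pt 0) (D.pt 1) R hR0 hne ?_
  filter_upwards [(hch D).2, h6 D] with c hc h6c
  exact ⟨h6c.1, hc.2.2.trans hR, hc.1, hc.2.1⟩

/-- Packaging (E3): assuming the class-level soft-Markov theorem, every chordal family `P`
carried by simple boundary-avoiding curves admits a kernel
`Q : DobrushinDomain → CurveClass ℂ → Measure (CurveClass ℂ)` satisfying the `initial` clause
`Q D (const (D.pt 0)) = P D` and the `markov` disintegration clause of
`ChordalFamily.IsMarkovExtension` for every `D` and every closed `F`. [folklore] -/
theorem stub_markovInitialOfChordalSimple : (∀ (μ : MeasureTheory.Measure (Literature.Probability.RandomPlanarGeometry.CurveClass ℂ)) [MeasureTheory.IsProbabilityMeasure μ] (a b : ℂ) (R : ℝ), 0 < R → a ≠ b → Filter.Eventually (fun c : Literature.Probability.RandomPlanarGeometry.CurveClass ℂ => c ∈ Literature.Probability.RandomPlanarGeometry.CurveClass.simple ∧ c.range ⊆ Metric.ball (0:ℂ) R ∧ c.source = a ∧ c.target = b) (MeasureTheory.ae μ) → ∃ Q : Literature.Probability.RandomPlanarGeometry.CurveClass ℂ → MeasureTheory.Measure (Literature.Probability.RandomPlanarGeometry.CurveClass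 ℂ), Q (Literature.Probability.RandomPlanarGeometry.CurveClass.mk (Literature.Probability.RandomPlanarGeometry.Curve.const a)) = μ ∧ ∀ F : Set ℂ, IsClosed F → ∀ S T : Set (Literature.Probability.RandomPlanarGeometry.CurveClass ℂ), MeasurableSet S → MeasurableSet T → μ (Literature.Probability.RandomPlanarGeometry.CurveClass.stopAt F ⁻¹' S ∩ Literature.Probability.RandomPlanarGeometry.CurveClass.startFrom F ⁻¹' T) = MeasureTheory.lintegral (μ.restrict (Literature.Probability.RandomPlanarGeometry.CurveClass.stopAt F ⁻¹' S)) (fun γ => Q (γ.stopAt F) T)) → ∀ P : Literature.Probability.RandomPlanarGeometry.ChordalFamily, P.IsChordal → (∀ D : Literature.Probability.RandomPlanarGeometry.DobrushinDomain, Filter.Eventually (fun γ : Literature.Probability.RandomPlanarGeometry.CurveClass ℂ => γ ∈ Literature.Probability.RandomPlanarGeometry.CurveClass.simple ∧ γ.range ∩ frontier D.carrier ⊆ {D.pt 0, D.pt 1}) (MeasureTheory.ae (P D))) → ∃ Q : Literature.Probability.RandomPlanarGeometry.DobrushinDomain → Literature.Probability.RandomPlanarGeometry.CurveClass ℂ →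 MeasureTheory.Measure (Literature.Probability.RandomPlanarGeometry.CurveClass ℂ), (∀ D : Literature.Probability.RandomPlanarGeometry.DobrushinDomain, Q D (Literature.Probability.RandomPlanarGeometry.CurveClass.mk (Literature.Probability.RandomPlanarGeometry.Curve.const (D.pt 0))) = P D) ∧ (∀ (D : Literature.Probability.RandomPlanarGeometry.DobrushinDomain) (F : Set ℂ), IsClosed F → ∀ S T : Set (Literature.Probability.RandomPlanarGeometry.CurveClass ℂ), MeasurableSet S → MeasurableSet T → P D (Literature.Probability.RandomPlanarGeometry.CurveClass.stopAt F ⁻¹' S ∩ Literature.Probability.RandomPlanarGeometry.CurveClass.startFrom F ⁻¹' T) = MeasureTheory.lintegral ((P D).restrict (Literature.Probability.RandomPlanarGeometry.CurveClass.stopAt F ⁻¹' S)) (fun γ => Q D (γ.stopAt F) T)) := by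
  intro hSoft P hch h6
  choose Q hQ using exists_markovKernel_of_isChordal_of_simple hSoft P hch h6
  exact ⟨Q, fun D => (hQ D).1, fun D F hF S T hS hT => (hQ D).2 F hF S T hS hT⟩

end Summit.CriticalPhenomena.SAWScalingLimit.Theorems.AxiomsOfLimitMarkov

end
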